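import Literature.NumberTheory.DiophantineApproximation.PolylogShiftHermitePade
import Literature.NumberTheory.DiophantineApproximation.PolylogHermitePadeBounds
import HarnessLib

/-!
# Type-I Hermite–Padé forms for the shifted polylogarithms: vanishing, positivity and size of the `m`-shift kernel

Topic `Literature/NumberTheory/DiophantineApproximation`. Elementary facts about the `m`-shift kernel
`K^{(m,w)}_n(u) = m^{2wn} (u − wn + 1)_{wn} / (mu + 1)_{n+1}^w` (`ShiftPade.kernelM`) and the `m`-shift form
`Λ^{(m,w)}_n(y) = ∑_{u ≥ 0} K^{(m,w)}_n(u) y^{u+1}` (`ShiftPade.formM`) of the sibling vocabulary file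
`PolylogShiftHermitePade.lean` (David–Hirata-Kohno–Kawashima 2020, Thm 2.1, shifts `r/m`), the `m`-shift
analogue of `PolylogTwoPointHermitePadeBounds.lean` (`m = 2`) and `PolylogHermitePadeBounds.lean`. The
numerator `(u − wn + 1)_{wn}` is literally the numerator of the one-point kernel `PolylogPade.kernelW`, so its
vanishing / positivity / size at the naturals are imported (`PolylogPade.pochNum_natCast_eq_zero`,
`PolylogPade.pochNum_natCast_pos`, `PolylogPade.pochNum_natCast_le_pow`, `PolylogPade.pochNum_self`); only
the denominator `(mu + 1)_{n+1}` (the one-point denominator `(t + 1)_{n+1}` at the variable `t = mu`) and the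
constant `m^{2wn}` change (positivity of the constant needs `m ≥ 1`):

* `kernelM_natCast_eq_zero` — the kernel vanishes at the naturals `u < wn`;
* `pochDenM_pos`, `pow_le_pochDenM_pow`, `kernelM_natCast_pos`, `kernelM_natCast_nonneg`,
  `kernelM_natCast_le` — for naturals `u ≥ wn` and `m ≥ 1`,
  `0 < (u − wn + 1)_{wn} ≤ (u+1)^{wn} ≤ (mu+1)^{wn} ≤ (mu+1)_{n+1}^w`, whence
  `0 < K^{(m,w)}_n(u) ≤ m^{2wn}`; together with the vanishing, `0 ≤ K^{(m,w)}_n(u) ≤ m^{2wn}` at every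
  natural `u`;
* `pochDenM_self_mul_factorial`, `kernelM_self` — the first nonzero coefficient
  `K^{(m,w)}_n(wn) = m^{2wn} (wn)! / ((mwn+1)(mwn+2)⋯((mw+1)n+1))^w = m^{2wn} (wn)! (mwn)!^w / ((mw+1)n+1)!^w`;
* `summable_formM`, `formM_pos`, `formM_le_div`, `formM_le`, `formM_ge` — for `0 ≤ y < 1` and `m ≥ 1` the
  series converges (comparison with `m^{2wn}` times the geometric series), `0 < Λ^{(m,w)}_n(y)` for `0 < y`,
  `Λ^{(m,w)}_n(y) ≤ m^{2wn} y^{wn+1}/(1 − y)` (only the terms `u ≥ wn` survive and `K ≤ m^{2wn}`), hence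
  `Λ^{(m,w)}_n(y) ≤ m^{2wn} y^{wn} = (m² y)^{wn}` for `y ≤ 1/2`, and
  `Λ^{(m,w)}_n(y) ≥ K^{(m,w)}_n(wn) y^{wn+1} = m^{2wn} (wn)! (mwn)!^w/((mw+1)n+1)!^w · y^{wn+1}`
  (all terms are `≥ 0`).

With `y = 1/M` these give `0 < Λ^{(m,w)}_n(1/M) ≤ (m²/M)^{wn}`, the "analytic half" of the linear
independence argument for `1` and the `Φ_{s,r}(1/M)` (`r ≤ m`, `s ≤ w`). Everything is proved from Mathlib and
the one-point file; no definitions, no named facts.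
-/

noncomputable section

open Finset

namespace Literature.NumberTheory.DiophantineApproximation

namespace ShiftPade

open Literature.NumberTheory.Transcendental

/-! ## The denominator at naturals -/

/-- The denominator base `(mu + 1)_{n+1} = ∏_{s ≤ n} (mu + 1 + s)` is positive at every natural `u`
(the one-point denominator `PolylogPade.pochDen_pos` at `t = mu`). [folklore] -/
theorem pochDenM_pos (m n u : ℕ) : 0 < BallRivoal.poch ((m : ℚ) * (u : ℚ) + 1) (n + 1) := by
  have h := PolylogPade.pochDen_pos n (m * u)
  push_cast at h
  exact h

/-- At every natural `u` the denominator dominates: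
`(mu + 1)^{wn} ≤ (mu + 1)^{w(n+1)} ≤ (mu + 1)_{n+1}^w` (the one-point `PolylogPade.pow_le_pochDen_pow`
at `t = mu`). [folklore] -/
theorem pow_le_pochDenM_pow (m w n u : ℕ) :
    ((m : ℚ) * (u : ℚ) + 1) ^ (w * n) ≤ BallRivoal.poch ((m : ℚ) * (u : ℚ) + 1) (n + 1) ^ w := by
  have h := PolylogPade.pow_le_pochDen_pow w n (m * u)
  push_cast at h
  exact h

/-! ## The kernel at naturals -/

/-- The `m`-shift kernel `K^{(m,w)}_n(u)` vanishes at the naturals `u < wn` (its numerator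
`(u − wn + 1)_{wn}` does): the series `Λ^{(m,w)}_n(y)` starts at `y^{wn+1}`.
[cite: DavidHirataKohnoKawashima2020, Thm 2.1] -/
theorem kernelM_natCast_eq_zero {m w n u : ℕ} (hu : u < w * n) : kernelM m w n u = 0 := by
  rw [kernelM, PolylogPade.pochNum_natCast_eq_zero hu, mul_zero, zero_div]

/-- The `m`-shift kernel `K^{(m,w)}_n(u)` is positive at the naturals `u ≥ wn` (`m ≥ 1`).
[cite: DavidHirataKohnoKawashima2020, Thm 2.1] -/
theorem kernelM_natCast_pos {m w n u : ℕ} (hm : 1 ≤ m) (hu : w * n ≤ u) : 0 < kernelM m w n u := by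
  have hm' : (0 : ℚ) < m := by exact_mod_cast hm
  unfold kernelM
  exact div_pos (mul_pos (pow_pos hm' _) (PolylogPade.pochNum_natCast_pos hu))
    (pow_pos (pochDenM_pos m n u) w)

/-- The `m`-shift kernel `K^{(m,w)}_n(u)` is nonnegative at every natural `u` (`m ≥ 1`).
[cite: DavidHirataKohnoKawashima2020, Thm 2.1] -/
theorem kernelM_natCast_nonneg (m w n u : ℕ) (hm : 1 ≤ m) : 0 ≤ kernelM m w n u := by
  rcases lt_or_ge u (w * n) with h | h
  · rw [kernelM_natCast_eq_zero h]
  · exact (kernelM_natCast_pos hm h).le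

/-- The `m`-shift kernel satisfies `K^{(m,w)}_n(u) ≤ m^{2wn}` at every natural `u` (`m ≥ 1`)
(`0 ≤ num ≤ (u+1)^{wn} ≤ (mu+1)^{wn} ≤ den` for `u ≥ wn`, and `K^{(m,w)}_n(u) = 0` for `u < wn`).
[cite: DavidHirataKohnoKawashima2020, Thm 2.1] -/
theorem kernelM_natCast_le (m w n u : ℕ) (hm : 1 ≤ m) : kernelM m w n u ≤ (m : ℚ) ^ (2 * (w * n)) := by
  rcases lt_or_ge u (w * n) with h | h
  · rw [kernelM_natCast_eq_zero h]
    positivity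
  · unfold kernelM
    rw [div_le_iff₀ (pow_pos (pochDenM_pos m n u) w)]
    refine mul_le_mul_of_nonneg_left ?_ (by positivity)
    have hu1 : (u : ℚ) + 1 ≤ (m : ℚ) * (u : ℚ) + 1 := by
      have hm' : (1 : ℚ) ≤ m := by exact_mod_cast hm
      have h1 := mul_le_mul_of_nonneg_right hm' (u.cast_nonneg : (0 : ℚ) ≤ u)
      linarith
    calc BallRivoal.poch ((u : ℚ) - w * n + 1) (w * n) ≤ ((u : ℚ) + 1) ^ (w * n) :=
          PolylogPade.pochNum_natCast_le_pow h
      _ ≤ ((m : ℚ) * (u : ℚ) + 1) ^ (w * n) := pow_le_pow_left₀ (by positivity) hu1 _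
      _ ≤ BallRivoal.poch ((m : ℚ) * (u : ℚ) + 1) (n + 1) ^ w := pow_le_pochDenM_pow m w n u

/-- `0 ≤ K^{(m,w)}_n(u)` at every natural `u`, as a real number (cast of `kernelM_natCast_nonneg`).
[cite: DavidHirataKohnoKawashima2020, Thm 2.1] -/
theorem kernelM_realCast_nonneg (m w n u : ℕ) (hm : 1 ≤ m) :
    (0 : ℝ) ≤ (kernelM m w n (u : ℚ) : ℝ) := by
  exact_mod_cast kernelM_natCast_nonneg m w n u hm

/-- `K^{(m,w)}_n(u) ≤ m^{2wn}` at every natural `u`, as a real number (cast of `kernelM_natCast_le`):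
the coefficients of `Λ^{(m,w)}_n` are bounded, so the series converges absolutely for `|y| < 1`.
[cite: DavidHirataKohnoKawashima2020, Thm 2.1] -/
theorem kernelM_realCast_le (m w n u : ℕ) (hm : 1 ≤ m) :
    (kernelM m w n (u : ℚ) : ℝ) ≤ (m : ℝ) ^ (2 * (w * n)) := by
  exact_mod_cast kernelM_natCast_le m w n u hm

/-! ## The first nonzero coefficient -/

/-- `(mwn + 1)_{n+1} · (mwn)! = ((mw+1)n + 1)!` (Mathlib's `Nat.factorial_mul_ascFactorial`).
[folklore] -/
theorem pochDenM_self_mul_factorial (m w n : ℕ) :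
    BallRivoal.poch ((m : ℚ) * ((w * n : ℕ) : ℚ) + 1) (n + 1) * ((m * w * n).factorial : ℚ) =
      ((((m * w + 1) * n + 1).factorial : ℚ)) := by
  have h := Nat.factorial_mul_ascFactorial (m * w * n) (n + 1)
  rw [Nat.ascFactorial_eq_prod_range, show m * w * n + (n + 1) = (m * w + 1) * n + 1 by ring] at h
  rw [mul_comm]
  unfold BallRivoal.poch
  have h' : ∀ s ∈ range (n + 1),
      ((m : ℚ) * ((w * n : ℕ) : ℚ) + 1 + (s : ℚ)) = ((m * w * n + 1 + s : ℕ) : ℚ) := by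
    intro s _
    push_cast
    ring
  rw [Finset.prod_congr rfl h', ← Nat.cast_prod]
  exact_mod_cast h

/-- **The first nonzero coefficient of `Λ^{(m,w)}_n`**:
`K^{(m,w)}_n(wn) = m^{2wn} (wn)! / ((mwn+1)(mwn+2)⋯((mw+1)n+1))^w = m^{2wn} (wn)! (mwn)!^w / ((mw+1)n+1)!^w`
(the hypothesis `m ≥ 1`, the range of the programme, is carried for uniformity of the interface but not used:
both sides make sense and agree also for `m = 0`). [cite: DavidHirataKohnoKawashima2020, Thm 2.1] -/
theorem kernelM_self (m w n : ℕ) (_hm : 1 ≤ m) :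
    kernelM m w n ((w * n : ℕ) : ℚ) =
      (m : ℚ) ^ (2 * (w * n)) * ((w * n).factorial : ℚ) * (((m * w * n).factorial : ℚ) ^ w) /
        ((((m * w + 1) * n + 1).factorial : ℚ) ^ w) := by
  have hP : 0 < BallRivoal.poch ((m : ℚ) * ((w * n : ℕ) : ℚ) + 1) (n + 1) := pochDenM_pos m n (w * n)
  have hf : (0 : ℚ) < (m * w * n).factorial := by exact_mod_cast Nat.factorial_pos _
  rw [kernelM, PolylogPade.pochNum_self, ← pochDenM_self_mul_factorial,
    div_eq_div_iff (pow_ne_zero _ hP.ne') (pow_ne_zero _ (mul_ne_zero hP.ne' hf.ne'))]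
  ring

/-! ## Convergence and the two-sided bounds for `Λ^{(m,w)}_n(y)` -/

/-- For `0 ≤ y < 1` (and `m ≥ 1`) the series `Λ^{(m,w)}_n(y) = ∑_{u ≥ 0} K^{(m,w)}_n(u) y^{u+1}` converges
(its terms lie between `0` and `m^{2wn}` times those of the geometric series).
[cite: DavidHirataKohnoKawashima2020, Thm 2.1] -/
theorem summable_formM (m w n : ℕ) (hm : 1 ≤ m) {y : ℝ} (hy : 0 ≤ y) (hy1 : y < 1) :
    Summable fun u : ℕ => (kernelM m w n (u : ℚ) : ℝ) * y ^ (u + 1) := by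
  have hg : Summable fun u : ℕ => (m : ℝ) ^ (2 * (w * n)) * y ^ (u + 1) := by
    refine ((summable_geometric_of_lt_one hy hy1).mul_left ((m : ℝ) ^ (2 * (w * n)) * y)).congr
      fun u => ?_
    ring
  refine Summable.of_nonneg_of_le (fun u => ?_) (fun u => ?_) hg
  · exact mul_nonneg (kernelM_realCast_nonneg m w n u hm) (pow_nonneg hy _)
  · exact mul_le_mul_of_nonneg_right (kernelM_realCast_le m w n u hm) (pow_nonneg hy _)

/-- **Positivity**: `0 < Λ^{(m,w)}_n(y)` for `0 < y < 1` and `m ≥ 1` (all terms are `≥ 0` and the term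
`u = wn` is `> 0`). [cite: DavidHirataKohnoKawashima2020, Thm 2.1] -/
theorem formM_pos (m w n : ℕ) (hm : 1 ≤ m) {y : ℝ} (hy : 0 < y) (hy1 : y < 1) : 0 < formM m w n y := by
  unfold formM
  have hwn : (0 : ℝ) < (kernelM m w n ((w * n : ℕ) : ℚ) : ℝ) := by
    exact_mod_cast kernelM_natCast_pos hm le_rfl
  exact (summable_formM m w n hm hy.le hy1).tsum_pos
    (fun u => mul_nonneg (kernelM_realCast_nonneg m w n u hm) (pow_nonneg hy.le _)) (w * n)
    (mul_pos hwn (pow_pos hy _))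

/-- **Tail bound**: `Λ^{(m,w)}_n(y) ≤ m^{2wn} y^{wn+1} / (1 − y)` for `0 ≤ y < 1` and `m ≥ 1` (the terms
`u < wn` vanish and `0 ≤ K^{(m,w)}_n(u) ≤ m^{2wn}` for the others, so
`Λ^{(m,w)}_n(y) ≤ m^{2wn} ∑_{u ≥ wn} y^{u+1}`). [cite: DavidHirataKohnoKawashima2020, Thm 2.1] -/
theorem formM_le_div (m w n : ℕ) (hm : 1 ≤ m) {y : ℝ} (hy : 0 ≤ y) (hy1 : y < 1) :
    formM m w n y ≤ (m : ℝ) ^ (2 * (w * n)) * y ^ (w * n + 1) / (1 - y) := by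
  have hs := summable_formM m w n hm hy hy1
  have h0 : ∑ u ∈ range (w * n), (kernelM m w n (u : ℚ) : ℝ) * y ^ (u + 1) = 0 :=
    Finset.sum_eq_zero fun u hu => by
      rw [kernelM_natCast_eq_zero (Finset.mem_range.1 hu), Rat.cast_zero, zero_mul]
  have hs' : Summable fun u : ℕ =>
      (kernelM m w n ((u + w * n : ℕ) : ℚ) : ℝ) * y ^ (u + w * n + 1) :=
    (summable_nat_add_iff (f := fun u : ℕ => (kernelM m w n (u : ℚ) : ℝ) * y ^ (u + 1)) (w * n)).2 hs
  have hg : Summable fun u : ℕ => (m : ℝ) ^ (2 * (w * n)) * y ^ (w * n + 1) * y ^ u :=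
    (summable_geometric_of_lt_one hy hy1).mul_left _
  unfold formM
  rw [← hs.sum_add_tsum_nat_add (w * n), h0, zero_add]
  calc ∑' u : ℕ, (kernelM m w n ((u + w * n : ℕ) : ℚ) : ℝ) * y ^ (u + w * n + 1)
      ≤ ∑' u : ℕ, (m : ℝ) ^ (2 * (w * n)) * y ^ (w * n + 1) * y ^ u := by
        refine hs'.tsum_le_tsum (fun u => ?_) hg
        calc (kernelM m w n ((u + w * n : ℕ) : ℚ) : ℝ) * y ^ (u + w * n + 1)
            ≤ (m : ℝ) ^ (2 * (w * n)) * y ^ (u + w * n + 1) :=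
              mul_le_mul_of_nonneg_right (kernelM_realCast_le m w n (u + w * n) hm) (pow_nonneg hy _)
          _ = (m : ℝ) ^ (2 * (w * n)) * y ^ (w * n + 1) * y ^ u := by ring
    _ = (m : ℝ) ^ (2 * (w * n)) * y ^ (w * n + 1) / (1 - y) := by
        rw [tsum_mul_left, tsum_geometric_of_lt_one hy hy1, div_eq_mul_inv]

/-- **Upper bound**: `Λ^{(m,w)}_n(y) ≤ m^{2wn} y^{wn} = (m² y)^{wn}` for `0 ≤ y ≤ 1/2` and `m ≥ 1`
(`Λ^{(m,w)}_n(y) ≤ m^{2wn} y^{wn+1}/(1 − y) ≤ m^{2wn} y^{wn}` as `y ≤ 1 − y`); at `y = 1/M`, `M ≥ 2`,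
this is `Λ^{(m,w)}_n(1/M) ≤ (m²/M)^{wn}`. [cite: DavidHirataKohnoKawashima2020, Thm 2.1] -/
theorem formM_le (m w n : ℕ) (hm : 1 ≤ m) {y : ℝ} (hy : 0 ≤ y) (hy1 : y ≤ 1 / 2) :
    formM m w n y ≤ (m : ℝ) ^ (2 * (w * n)) * y ^ (w * n) := by
  have hy1' : y < 1 := by linarith
  refine (formM_le_div m w n hm hy hy1').trans ?_
  rw [div_le_iff₀ (by linarith), pow_succ, ← mul_assoc]
  exact mul_le_mul_of_nonneg_left (by linarith) (by positivity)

/-- **Lower bound**: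
`Λ^{(m,w)}_n(y) ≥ K^{(m,w)}_n(wn) y^{wn+1} = m^{2wn} (wn)! (mwn)!^w/((mw+1)n+1)!^w · y^{wn+1}` for
`0 ≤ y < 1` and `m ≥ 1` (all terms are nonnegative; keep the first nonzero one).
[cite: DavidHirataKohnoKawashima2020, Thm 2.1] -/
theorem formM_ge (m w n : ℕ) (hm : 1 ≤ m) {y : ℝ} (hy : 0 ≤ y) (hy1 : y < 1) :
    (m : ℝ) ^ (2 * (w * n)) * ((w * n).factorial : ℝ) * (((m * w * n).factorial : ℝ) ^ w) /
        ((((m * w + 1) * n + 1).factorial : ℝ) ^ w) * y ^ (w * n + 1) ≤ formM m w n y := by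
  have h : (kernelM m w n ((w * n : ℕ) : ℚ) : ℝ) =
      (m : ℝ) ^ (2 * (w * n)) * ((w * n).factorial : ℝ) * (((m * w * n).factorial : ℝ) ^ w) /
        ((((m * w + 1) * n + 1).factorial : ℝ) ^ w) := by
    rw [kernelM_self m w n hm]
    push_cast
    rfl
  rw [formM, ← h]
  exact (summable_formM m w n hm hy hy1).le_tsum (w * n) fun u _ =>
    mul_nonneg (kernelM_realCast_nonneg m w n u hm) (pow_nonneg hy _)

end ShiftPade

end Literature.NumberTheory.DiophantineApproximation
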